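import Literature.MathematicalPhysics.QuantumFieldTheory.Balaban1983to89.Beta.ResolventCompositionStepB
import Literature.MathematicalPhysics.QuantumFieldTheory.Balaban1983to89.Beta.KKTFluctuationEnergy
import Literature.MathematicalPhysics.QuantumFieldTheory.Balaban1983to89.Beta.PeriodicDescent

/-!
# `BalabanUV.Beta.GAN24.PeriodicKKTResponse` — binder row G-an2-4 ∕ (CONV-C), W-slot CT-W, conservation law (C)∕(C)sym: **THE RESPONSE OF THE `U = 1`
# KKT RESOLVENT TO A BOUNDED BLOCK-PERIODIC FORCE AS A SUPERPOSITION OF `Γ`-COLUMNS — block covariance of `Γ ∕ Γ^Φ ∕ Γ^M`, summability of the three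
# columns in the source, block-periodicity of the superposed field, and ITS EULER–LAGRANGE ROW with the force split off:
# `curvAdj (curv A) μ x = Σ'_y Σ_l J l y·(contourSumAdj N Γ^Φ-col + dz codiff₁ dz Γ^M-col) μ x + J μ x`** (part 1 of step (P2) of the route (d′) of this lineage's
# note `HOME/b2b-balaban-gan24-formalise-leaf-04/g64/CSYM-D3-ANATOMY.md` §8; generic `d`, every block factor `N ≥ 1`)

NOT IN PRINT; OUR BOOKKEEPING ([folklore] tsum bookkeeping BY NAME over an2∕an5's `KKTFluctuationKernel` (`Gam ∕ GamΦ ∕ GamM`, `Gam_EL`, `decay_Gam ∕ decay_wΓφ ∕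
decay_wΓμ`, `l1_sub_le ∕ l1_repZ_le`), `KKTFluctuationEnergy` (`summable_of_exp_bound`, `summable_mul_of_bdd`), `KernelSpecInstance.exp_quo_le`, an5's
`ResolventCompositionStepB` interchange lemmas (`curv_tsum ∕ curvAdj_tsum ∕ curv_finsum_mul ∕ curvAdj_finsum_mul`), `BlochFibreUniqueness.quo_add_zsmul`,
`BlochFibreMatrix.eq_repZ_add_zsmul_quo`; G-an2-4 formalisation swarm, leaf prover `b2b-balaban-gan24-formalise-leaf-04`, gen 64).  MODEL: an5's §9.2 superposition
`sup1 ∕ curvAdj_curv_sup1` with the roles of decay SWAPPED (there: summable coefficients × bounded kernels; here: BOUNDED block-periodic coefficients × kernels decaying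
in the separation).  HONEST FRAMING (cell contract, verbatim): «discharging `BetaPertH` makes Bałaban's UV stability UNCONDITIONAL — a real constructive-QFT result; it
is NOT the continuum limit and NOT the Clay problem.»  HONEST DEPENDENCY (verbatim): «continuum YM on T⁴ ⇐ BetaPertH ∧ nine spine estimates (0/9 proved); BetaPertH ⇐
(D1) ∧ (D4) ∧ CAP+tail; G-an2-4 gates asym, D1 and NE2/3/4.»

WHY (note §8 (d′)∕(e)): the cubic × cubic exchange of one dressed second-order step is `⟨J′, K·J⟩_cell` with `J` the block-periodic edge current; `K·J` is the present
superposition.  With its Euler–Lagrange row (this file), its averaging multiplier `φ = 0` (`GAN24.PeriodicForceMultiplier`), the gauge drop and the flux identity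
(`GAN24.PeriodicCellPairing.card_mul_curv_add_half_eq`, `GAN24.HarmonicPeriodicTwoForm`), `curv (K·J) = ½(avg F − F)`.  REMAINING after this part (not here): the
(G)∕(M)∕(Q) rows of the superposition and the packaging as `KKTFluctuationUnique.SolvesKKT N J 0`, the identification of `Σ' Σ_l J·Γ^Φ-col` with the
`PeriodicForceMultiplier` row through `ResolventCompositionStepB.KInvStep_inl_inl ∕ OneStepResolventKernel.KInv_inr_inl_coarse`, and block-periodicity of the gauge
potential — part 2.

WHAT ([folklore]; 0 `def`, 0 cited facts, 0 `def … : Prop`, 0 sorry): §1 `Gam_add_zsmul`, `GamΦ_add`, `GamM_add_zsmul` (block covariance), `summable_Gam`,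
`summable_mul_Gam`, `summable_sum_mul_Gam`, `respA_periodic`, `summable_GamΦ`, `summable_GamM`; §2 **`curvAdj_curv_resp`** (the EL operator passes through the
superposition), `summable_sum_mul_curvAdj_curv_Gam`, **`curvAdj_curv_resp_eq`** (the EL row with the force split off).  Asserts NO value of Bałaban's tables; discharges
NOTHING of (C)sym ∕ (Q-D) ∕ (Q-D-rate) ∕ «T2Shape» ∕ «T2Drift» ∕ (hW, hWall); NEVER «G-an2-4 closed» as (CONV-C); NOT D1, NOT `BetaPertH`, NOT continuum, NOT Clay.
2026-08-22; no existing file touched.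
-/

noncomputable section

open Finset
open scoped BigOperators
open Literature.MathematicalPhysics.QuantumFieldTheory
open Literature.MathematicalPhysics.QuantumFieldTheory.Balaban1983to89.Beta
open Literature.Probability.LatticeModels (TorusSite Torus.proj Torus.proj_apply)
open AffineAveraging (Form0 Form1 Form2 unitVec dz curv curvAdj codiff₁ box toSite)
open LatticeForm (repZ quo proj_repZ proj_add_zsmul)
open BlochFibreUniqueness (quo_add_zsmul)
open KKTFluctuationKernel (Gam GamΦ GamM decay_Gam Gam_EL)
open AffineReproduction (contourSumAdj)
open KKTFluctuationEnergy (summable_mul_of_bdd)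
open KKTFluctuationEnergy (summable_of_exp_bound summable_mul_of_bdd')
open PeriodicDescent (IsPeriodic)
open Balaban1983to89.B12Sec2to5 (l1)

namespace Summit.QuantumFields.BalabanUV.Beta.GAN24.PeriodicKKTResponse

variable {d N : ℕ} [NeZero N]

/-! ## §1 Block covariance, summability in the source, periodicity of the superposed field -/

/-- [folklore] Block covariance of `Γ`. -/
theorem Gam_add_zsmul (κ : Fin (d + 1)) (x : AffineAveraging.Site (d + 1)) (l : Fin (d + 1)) (y t : AffineAveraging.Site (d + 1)) :
    Gam (N := N) κ (x + (N : ℤ) • t) l (y + (N : ℤ) • t) = Gam (N := N) κ x l y := by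
  simp only [Gam, proj_add_zsmul, quo_add_zsmul, smul_add]
  congr 1
  abel

/-- [folklore] Block covariance of `Γ^Φ` (coarse index shifted by `t`). -/
theorem GamΦ_add (κ : Fin (d + 1)) (q : AffineAveraging.Site (d + 1)) (l : Fin (d + 1)) (y t : AffineAveraging.Site (d + 1)) :
    GamΦ (N := N) κ (q + t) l (y + (N : ℤ) • t) = GamΦ (N := N) κ q l y := by
  simp only [GamΦ, proj_add_zsmul, quo_add_zsmul]
  congr 1
  abel

/-- [folklore] Block covariance of `Γ^M`. -/
theorem GamM_add_zsmul (z : AffineAveraging.Site (d + 1)) (l : Fin (d + 1)) (y t : AffineAveraging.Site (d + 1)) :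
    GamM (N := N) (z + (N : ℤ) • t) l (y + (N : ℤ) • t) = GamM (N := N) z l y := by
  simp only [GamM, proj_add_zsmul, quo_add_zsmul, smul_add]
  congr 1
  abel

/-- [folklore] The `Γ`-column `Γ κ x l ·` is summable in the source (exponential decay in the separation). -/
theorem summable_Gam (κ : Fin (d + 1)) (x : AffineAveraging.Site (d + 1)) (l : Fin (d + 1)) :
    Summable fun y => Gam (N := N) κ x l y := by
  obtain ⟨δ, C, hδ, _, h⟩ := decay_Gam (N := N) (d := d)
  refine summable_of_exp_bound (C := C) hδ x fun y => ?_
  have e : l1 (y - x) = l1 (x - y) := by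
    simp only [l1]
    exact Finset.sum_congr rfl fun i _ => by rw [Pi.sub_apply, Pi.sub_apply, Int.cast_sub, Int.cast_sub, abs_sub_comm]
  rw [e]
  exact h κ x l y

/-- [folklore] The `Γ`-row against a bounded force is summable. -/
theorem summable_mul_Gam {J : Form1 (d + 1) ℝ} {B : ℝ} (hJ : ∀ l y, |J l y| ≤ B) (κ : Fin (d + 1)) (x : AffineAveraging.Site (d + 1))
    (l : Fin (d + 1)) : Summable fun y => J l y * Gam (N := N) κ x l y :=
  summable_mul_of_bdd (fun y => hJ l y) (summable_Gam (N := N) κ x l)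

/-- [folklore] … summed over the source direction. -/
theorem summable_sum_mul_Gam {J : Form1 (d + 1) ℝ} {B : ℝ} (hJ : ∀ l y, |J l y| ≤ B) (κ : Fin (d + 1)) (x : AffineAveraging.Site (d + 1)) :
    Summable fun y => ∑ l, J l y * Gam (N := N) κ x l y :=
  summable_sum fun l _ => summable_mul_Gam (N := N) hJ κ x l

/-- [folklore] The superposed field response `A κ x := Σ'_y Σ_l J l y · Γ κ x l y` of a block-periodic force is block-periodic. -/
theorem respA_periodic {J : Form1 (d + 1) ℝ} (hJp : ∀ l y t, J l (y + (N : ℤ) • t) = J l y) (κ : Fin (d + 1))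
    (x t : AffineAveraging.Site (d + 1)) :
    ∑' y, ∑ l, J l y * Gam (N := N) κ (x + (N : ℤ) • t) l y = ∑' y, ∑ l, J l y * Gam (N := N) κ x l y := by
  rw [← (Equiv.addRight ((N : ℤ) • t)).tsum_eq (fun y => ∑ l, J l y * Gam (N := N) κ (x + (N : ℤ) • t) l y)]
  refine tsum_congr fun y => Finset.sum_congr rfl fun l _ => ?_
  simp only [Equiv.coe_addRight, Gam_add_zsmul, hJp]

/-! ## §2 The Euler–Lagrange row of the superposed response, column form -/

/-- [folklore] `curvAdj ∘ curv` passes through the superposition: the EL operator of `A = Σ' Σ_l J·Γ-col` is the superposition of the columns' EL values. -/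
theorem curvAdj_curv_resp {J : Form1 (d + 1) ℝ} {B : ℝ} (hJ : ∀ l y, |J l y| ≤ B) :
    curvAdj (curv (fun κ x => ∑' y, ∑ l, J l y * Gam (N := N) κ x l y)) =
      fun μ x => ∑' y, ∑ l, J l y * curvAdj (curv (fun κ z => Gam (N := N) κ z l y)) μ x := by
  have hs : ∀ κ x, Summable fun y => ∑ l, J l y * Gam (N := N) κ x l y := fun κ x => summable_sum_mul_Gam (N := N) hJ κ x
  rw [ResolventCompositionStepB.curv_tsum (f := fun y κ x => ∑ l, J l y * Gam (N := N) κ x l y) hs]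
  have hs2 : ∀ κ l x, Summable fun y => curv (fun κ x => ∑ l, J l y * Gam (N := N) κ x l y) κ l x := by
    intro κ l x
    show Summable fun y => (∑ l', J l' y * Gam (N := N) κ x l' y) + (∑ l', J l' y * Gam (N := N) l (x + unitVec κ) l' y)
      - (∑ l', J l' y * Gam (N := N) κ (x + unitVec l) l' y) - (∑ l', J l' y * Gam (N := N) l x l' y)
    exact (((hs κ x).add (hs l _)).sub (hs κ _)).sub (hs l x)
  rw [ResolventCompositionStepB.curvAdj_tsum hs2]
  funext μ x
  refine tsum_congr fun y => ?_
  rw [ResolventCompositionStepB.curv_finsum_mul, ResolventCompositionStepB.curvAdj_finsum_mul]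

/-- [folklore] The multiplier column `GamΦ κ q l ·` is summable in the source (decay in the source's block index, read at the fine point). -/
theorem summable_GamΦ (κ : Fin (d + 1)) (q : AffineAveraging.Site (d + 1)) (l : Fin (d + 1)) :
    Summable fun y => GamΦ (N := N) κ q l y := by
  obtain ⟨δ, C, hδ, hC, h⟩ := KKTFluctuationKernel.decay_wΓφ (N := N) (d := d)
  have hN : (0 : ℝ) < N := by exact_mod_cast Nat.pos_of_ne_zero (NeZero.ne N)
  refine summable_of_exp_bound (C := C * Real.exp (δ * (d + 1))) (δ := δ / N) (div_pos hδ hN) ((N : ℤ) • q) fun y => ?_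
  have hq : q - quo N y = -quo N (y - (N : ℤ) • q) := by
    rw [show y - (N : ℤ) • q = y + (N : ℤ) • (-q) by rw [smul_neg, sub_eq_add_neg], quo_add_zsmul]
    abel
  have h1 := h l (Torus.proj N y) κ (q - quo N y)
  simp only [GamΦ]
  refine h1.trans ?_
  rw [hq, OneStepKernelFamily.l1_neg_eq, mul_assoc]
  refine mul_le_mul_of_nonneg_left ?_ hC
  have e := KernelSpecInstance.exp_quo_le (N := N) (d := d) hδ (y - (N : ℤ) • q)
  rw [show -(δ * l1 (quo N (y - (N : ℤ) • q))) = -δ * l1 (quo N (y - (N : ℤ) • q)) by ring] at e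
  exact e

/-- [folklore] The gauge column `GamM z l ·` is summable in the source. -/
theorem summable_GamM (z : AffineAveraging.Site (d + 1)) (l : Fin (d + 1)) :
    Summable fun y => GamM (N := N) z l y := by
  obtain ⟨δ, C, hδ, hC, h⟩ := KKTFluctuationKernel.decay_wΓμ (N := N) (d := d)
  refine summable_of_exp_bound (C := C * Real.exp (δ * ((N : ℝ) * (d + 1)))) (δ := δ) hδ z fun y => ?_
  have hy : y = repZ (Torus.proj N y) + (N : ℤ) • quo N y := BlochFibreMatrix.eq_repZ_add_zsmul_quo y
  have hq : (N : ℤ) • quo N y = y - repZ (Torus.proj N y) := by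
    have e := hy
    exact (eq_sub_of_add_eq' e.symm)
  have hsplit : z - (N : ℤ) • quo N y = (z - y) + repZ (Torus.proj N y) := by
    rw [hq]
    abel
  have hl1 : l1 (y - z) ≤ l1 (z - (N : ℤ) • quo N y) + (N : ℝ) * (d + 1) := by
    have e1 : l1 (y - z) = l1 (z - y) := by rw [show y - z = -(z - y) by abel, OneStepKernelFamily.l1_neg_eq]
    have e2 : z - y = (z - (N : ℤ) • quo N y) - repZ (Torus.proj N y) := by rw [hsplit]; abel
    rw [e1, e2]
    exact (KKTFluctuationKernel.l1_sub_le _ _).trans (by linarith [KKTFluctuationKernel.l1_repZ_le (N := N) (Torus.proj N y)])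
  have h1 := h l (Torus.proj N y) (z - (N : ℤ) • quo N y)
  simp only [GamM]
  refine h1.trans ?_
  rw [mul_assoc, ← Real.exp_add]
  refine mul_le_mul_of_nonneg_left (Real.exp_le_exp.2 ?_) hC
  nlinarith [hl1, hδ]

/-- [folklore] Summability of the EL value of the superposition's columns (a finite combination of `Γ`-rows). -/
theorem summable_sum_mul_curvAdj_curv_Gam {J : Form1 (d + 1) ℝ} {B : ℝ} (hJ : ∀ l y, |J l y| ≤ B) (μ : Fin (d + 1))
    (x : AffineAveraging.Site (d + 1)) :
    Summable fun y => ∑ l, J l y * curvAdj (curv (fun κ z => Gam (N := N) κ z l y)) μ x := by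
  have hs : ∀ κ x, Summable fun y => ∑ l, J l y * Gam (N := N) κ x l y := fun κ x => summable_sum_mul_Gam (N := N) hJ κ x
  have e : ∀ y, ∑ l, J l y * curvAdj (curv (fun κ z => Gam (N := N) κ z l y)) μ x =
      curvAdj (curv (fun κ z => ∑ l, J l y * Gam (N := N) κ z l y)) μ x := by
    intro y
    rw [ResolventCompositionStepB.curv_finsum_mul, ResolventCompositionStepB.curvAdj_finsum_mul]
  simp_rw [e]
  set f : AffineAveraging.Site (d + 1) → Form1 (d + 1) ℝ := fun y κ z => ∑ l, J l y * Gam (N := N) κ z l y with hf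
  have hcurv : ∀ κ l z, Summable fun y => curv (f y) κ l z := by
    intro κ l z
    show Summable fun y => f y κ z + f y l (z + unitVec κ) - f y κ (z + unitVec l) - f y l z
    exact (((hs κ z).add (hs l _)).sub (hs κ _)).sub (hs l z)
  show Summable fun y => (∑ l, (curv (f y) μ l x - curv (f y) μ l (x - unitVec l))) + ∑ κ, (curv (f y) κ μ (x - unitVec κ) - curv (f y) κ μ x)
  exact (summable_sum fun l _ => (hcurv μ l x).sub (hcurv μ l _)).add (summable_sum fun κ _ => (hcurv κ μ _).sub (hcurv κ μ x))

/-- [folklore] **THE EULER–LAGRANGE ROW OF THE SUPERPOSED RESPONSE, FORCE SPLIT OFF**: with `Gam_EL` inserted column by column and the delta force resummed,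
`curvAdj (curv A) μ x = Σ'_y Σ_l J l y·(contourSumAdj N (GamΦ-col) μ x + dz (codiff₁ (dz (GamM-col))) μ x) + J μ x`. -/
theorem curvAdj_curv_resp_eq {J : Form1 (d + 1) ℝ} {B : ℝ} (hJ : ∀ l y, |J l y| ≤ B) (μ : Fin (d + 1)) (x : AffineAveraging.Site (d + 1)) :
    curvAdj (curv (fun κ x => ∑' y, ∑ l, J l y * Gam (N := N) κ x l y)) μ x =
      (∑' y, ∑ l, J l y * (contourSumAdj N (fun κ q => GamΦ (N := N) κ q l y) μ x
        + dz (codiff₁ (dz (fun z => GamM (N := N) z l y))) μ x)) + J μ x := by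
  rw [curvAdj_curv_resp (N := N) hJ]
  have htot := summable_sum_mul_curvAdj_curv_Gam (N := N) hJ μ x
  -- pointwise split: EL value of the column = (multiplier + gauge part) + delta
  have hpt : ∀ y, ∑ l, J l y * curvAdj (curv (fun κ z => Gam (N := N) κ z l y)) μ x =
      ∑ l, J l y * (contourSumAdj N (fun κ q => GamΦ (N := N) κ q l y) μ x + dz (codiff₁ (dz (fun z => GamM (N := N) z l y))) μ x)
        + (if x = y then J μ y else 0) := by
    intro y
    simp only [Gam_EL, mul_add, Finset.sum_add_distrib]
    congr 1
    by_cases hxy : x = y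
    · subst hxy
      simp only [and_true, if_true, mul_ite, mul_one, mul_zero]
      rw [Finset.sum_ite_eq Finset.univ μ (fun l => J l x)]
      simp
    · simp [hxy]
  have hδs : Summable fun y => if x = y then J μ y else 0 := by
    apply summable_of_ne_finset_zero (s := {x})
    intro y hy
    rw [Finset.mem_singleton] at hy
    simp [Ne.symm hy]
  have hrest : Summable fun y => ∑ l, J l y * (contourSumAdj N (fun κ q => GamΦ (N := N) κ q l y) μ x
      + dz (codiff₁ (dz (fun z => GamM (N := N) z l y))) μ x) := by
    have e : ∀ y, ∑ l, J l y * (contourSumAdj N (fun κ q => GamΦ (N := N) κ q l y) μ x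
        + dz (codiff₁ (dz (fun z => GamM (N := N) z l y))) μ x) =
        ∑ l, J l y * curvAdj (curv (fun κ z => Gam (N := N) κ z l y)) μ x - (if x = y then J μ y else 0) := by
      intro y; rw [hpt y]; ring
    simp_rw [e]
    exact htot.sub hδs
  show (∑' y, ∑ l, J l y * curvAdj (curv (fun κ z => Gam (N := N) κ z l y)) μ x) = _
  have hδv : ∑' y, (if x = y then J μ y else 0) = J μ x := by
    rw [tsum_eq_single x (fun y hy => by simp [Ne.symm hy])]
    simp
  rw [tsum_congr hpt, hrest.tsum_add hδs, hδv]

end Summit.QuantumFields.BalabanUV.Beta.GAN24.PeriodicKKTResponse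

end
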